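import Summits.Ventures.PackingBounds.Configurations.Dim7Card56Design
import Summits.Ventures.PackingBounds.Configurations.CrossPolytopeUnique

/-!
# `(7, 56, 1/3)` codes contain a `1/3`-frame of seven points

Framing: lottery ticket; floor = certified bounds/negative ranges. Venture `PackingBounds` (cell
`pub-packcert`, seat `pub-packcert-energy`) — Cohn–Kumar Table 1, row `(7, 56)`, uniqueness column, step 2 of 3.

For `x ∈ C`, a point `x₀` at `1/3` from `x` (`exists_inner_eq_third`), and a point `y₀` at `1/3` from both
(`card_filter_eq_sixteen`: there are exactly `16`, the `λ` of the Gosset graph), the set `K` of points at `1/3`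
from `x, x₀` and at `-1/3` from `y₀` has exactly five elements (`card_filter_eq_five`, read off the cubic
functional `(1+3⟪x,w⟫)(1+3⟪x₀,w⟫)(1-3⟪y₀,w⟫)/8` with the design identities of `Dim7Card56Design`) and is a
`1/3`-clique (`inner_eq_third_of_mem`: two of its points at `-1/3` would force `y₀ + w + w' = x`). Hence
`{x, x₀} ∪ K` is a `1/3`-frame of seven points of `C` (`exists_frame`) — a basis of `ℝ⁷` (`CliqueFrame`).

## References
* E. Bannai, N. J. A. Sloane, Canad. J. Math. 33 (1981) 437–449 (= Conway–Sloane, *SPLAG*, Ch. 14 Thm 10–12). [`ConwaySloane1999`]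
* H. Cohn, A. Kumar, J. Amer. Math. Soc. 20 (2007) 99–148, Table 1 and Appendix A. [`CohnKumar2006`]
-/

noncomputable section

namespace Summit.Ventures.PackingBounds.Config.Dim7Card56Unique

open Finset Module Literature.Analysis.SpecialFunctions Literature.Geometry.DiscreteGeometry

section config

variable {C : Finset (EuclideanSpace ℝ (Fin 7))} (h1 : ∀ x ∈ C, ‖x‖ = 1)
  (h2 : ∀ x ∈ C, ∀ y ∈ C, x ≠ y → inner ℝ x y ≤ 1 / 3) (hN : C.card = 56)
include h1 h2 hN
/-! ### The frame -/

/-- Every point has a point at inner product `1/3`. -/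
theorem exists_inner_eq_third {x : EuclideanSpace ℝ (Fin 7)} (hx : x ∈ C) :
    ∃ y ∈ C, inner ℝ x y = 1 / 3 := by
  by_contra hcon
  push Not at hcon
  have hval : ∀ w ∈ C.erase x, inner ℝ x w ≤ -1 / 3 := by
    intro w hw
    obtain ⟨hne, hwC⟩ := mem_erase.mp hw
    rcases inner_of_card_eq_56 h1 h2 hN hx hwC (Ne.symm hne) with h | h | h
    · exact absurd h (hcon w hwC)
    · rw [h]
    · rw [h]; norm_num
  have hs := sum_inner_eq_zero h1 h2 hN x
  rw [← Finset.add_sum_erase C _ hx, real_inner_self_eq_norm_sq, h1 x hx] at hs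
  have hle := Finset.sum_le_card_nsmul (C.erase x) (fun w => inner ℝ x w) (-1 / 3) hval
  rw [card_erase_of_mem hx, hN, nsmul_eq_mul] at hle
  norm_num at hle
  linarith

/-- For `⟪x, x₀⟫ = 1/3`: exactly `16` points are at `1/3` from both `x` and `x₀` (the Gosset graph has
`λ = 16`). -/
theorem card_filter_eq_sixteen {x x₀ : EuclideanSpace ℝ (Fin 7)} (hx : x ∈ C) (hx₀ : x₀ ∈ C)
    (hxx₀ : inner ℝ x x₀ = 1 / 3) :
    (C.filter fun w => inner ℝ x w = 1 / 3 ∧ inner ℝ x₀ w = 1 / 3).card = 16 := by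
  classical
  have hx₀x : inner ℝ x₀ x = 1 / 3 := by rw [real_inner_comm]; exact hxx₀
  have hne : x ≠ x₀ := by
    intro h; rw [h, real_inner_self_eq_norm_sq, h1 x₀ hx₀] at hxx₀; norm_num at hxx₀
  set P : EuclideanSpace ℝ (Fin 7) → Prop := fun w => inner ℝ x w = 1 / 3 ∧ inner ℝ x₀ w = 1 / 3 with hP
  set F : EuclideanSpace ℝ (Fin 7) → ℝ := fun w => (1 + 3 * inner ℝ x w) * (1 + 3 * inner ℝ x₀ w) / 4
    with hF
  have htot : ∑ w ∈ C, F w = 20 := by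
    have hexp : ∀ w, F w = 1 / 4 + 3 / 4 * inner ℝ x w + 3 / 4 * inner ℝ x₀ w
        + 9 / 4 * (inner ℝ x w * inner ℝ x₀ w) := fun w => by rw [hF]; ring
    rw [Finset.sum_congr rfl fun w _ => hexp w, Finset.sum_add_distrib, Finset.sum_add_distrib,
      Finset.sum_add_distrib, ← Finset.mul_sum, ← Finset.mul_sum, ← Finset.mul_sum, sum_inner_eq_zero h1 h2 hN x,
      sum_inner_eq_zero h1 h2 hN x₀, sum_inner_mul_inner h1 h2 hN x x₀, hxx₀, sum_const, hN]
    norm_num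
  have hsplit := Finset.sum_filter_add_sum_filter_not C P F
  have hK : ∑ w ∈ C.filter P, F w = ((C.filter P).card : ℝ) := by
    rw [Finset.sum_congr rfl (fun w hw => ?_), sum_const, nsmul_eq_mul, mul_one]
    obtain ⟨_, hw1, hw2⟩ := mem_filter.mp hw
    rw [hF]
    simp only [hw1, hw2]
    norm_num
  have hrest : ∑ w ∈ C.filter (fun w => ¬ P w), F w = 4 := by
    have hval : ∀ w ∈ C.filter (fun w => ¬ P w), F w = (if w = x then 2 else 0) + (if w = x₀ then 2 else 0) := by
      intro w hw
      obtain ⟨hwC, hnp⟩ := mem_filter.mp hw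
      by_cases hwx : w = x
      · rw [if_pos hwx, if_neg (by rw [hwx]; exact hne), hwx, hF]
        simp only [real_inner_self_eq_norm_sq, h1 x hx, hx₀x]
        norm_num
      rw [if_neg hwx]
      by_cases hwx₀ : w = x₀
      · rw [if_pos hwx₀, hwx₀, hF]
        simp only [real_inner_self_eq_norm_sq, h1 x₀ hx₀, hxx₀]
        norm_num
      rw [if_neg hwx₀, hF]
      rcases inner_of_card_eq_56 h1 h2 hN hx hwC (Ne.symm hwx) with ha | ha | ha
      · rcases inner_of_card_eq_56 h1 h2 hN hx₀ hwC (Ne.symm hwx₀) with hb | hb | hb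
        · exact absurd ⟨ha, hb⟩ hnp
        · simp only [hb]; norm_num
        · -- `w = -x₀`, contradicting `⟪x, w⟫ = 1/3`
          have hw := CrossPolytopeUnique.eq_neg_of_inner_eq_neg_one (h1 x₀ hx₀) (h1 w hwC) hb
          rw [hw, inner_neg_right, hxx₀] at ha
          norm_num at ha
      · simp only [ha]; norm_num
      · have hw := CrossPolytopeUnique.eq_neg_of_inner_eq_neg_one (h1 x hx) (h1 w hwC) ha
        rw [hw]
        simp only [inner_neg_right, hx₀x, real_inner_self_eq_norm_sq, h1 x hx]
        norm_num
    have hxm : x ∈ C.filter (fun w => ¬ P w) := by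
      refine mem_filter.mpr ⟨hx, fun ⟨h, _⟩ => ?_⟩
      rw [real_inner_self_eq_norm_sq, h1 x hx] at h
      norm_num at h
    have hx₀m : x₀ ∈ C.filter (fun w => ¬ P w) := by
      refine mem_filter.mpr ⟨hx₀, fun ⟨_, h⟩ => ?_⟩
      rw [real_inner_self_eq_norm_sq, h1 x₀ hx₀] at h
      norm_num at h
    rw [Finset.sum_congr rfl hval, Finset.sum_add_distrib, Finset.sum_ite_eq' _ x, Finset.sum_ite_eq' _ x₀,
      if_pos hxm, if_pos hx₀m]
    norm_num
  rw [hK, hrest] at hsplit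
  have h16 : ((C.filter P).card : ℝ) = ((16 : ℕ) : ℝ) := by push_cast; linarith
  exact Nat.cast_injective h16

/-- For `x, x₀, y₀` pairwise at `1/3`: exactly `5` points are at `1/3` from `x, x₀` and `-1/3` from `y₀`. -/
theorem card_filter_eq_five {x x₀ y₀ : EuclideanSpace ℝ (Fin 7)} (hx : x ∈ C) (hx₀ : x₀ ∈ C) (hy₀ : y₀ ∈ C)
    (hxx₀ : inner ℝ x x₀ = 1 / 3) (hxy₀ : inner ℝ x y₀ = 1 / 3) (hx₀y₀ : inner ℝ x₀ y₀ = 1 / 3) :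
    (C.filter fun w => inner ℝ x w = 1 / 3 ∧ inner ℝ x₀ w = 1 / 3 ∧ inner ℝ y₀ w = -1 / 3).card = 5 := by
  classical
  have hx₀x : inner ℝ x₀ x = 1 / 3 := by rw [real_inner_comm]; exact hxx₀
  have hy₀x : inner ℝ y₀ x = 1 / 3 := by rw [real_inner_comm]; exact hxy₀
  have hy₀x₀ : inner ℝ y₀ x₀ = 1 / 3 := by rw [real_inner_comm]; exact hx₀y₀
  have hne1 : x ≠ y₀ := by
    intro h; rw [h, real_inner_self_eq_norm_sq, h1 y₀ hy₀] at hxy₀; norm_num at hxy₀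
  have hne2 : x₀ ≠ y₀ := by
    intro h; rw [h, real_inner_self_eq_norm_sq, h1 y₀ hy₀] at hx₀y₀; norm_num at hx₀y₀
  set P : EuclideanSpace ℝ (Fin 7) → Prop :=
    fun w => inner ℝ x w = 1 / 3 ∧ inner ℝ x₀ w = 1 / 3 ∧ inner ℝ y₀ w = -1 / 3 with hP
  set F : EuclideanSpace ℝ (Fin 7) → ℝ :=
    fun w => (1 + 3 * inner ℝ x w) * (1 + 3 * inner ℝ x₀ w) * (1 - 3 * inner ℝ y₀ w) / 8 with hF
  have htot : ∑ w ∈ C, F w = 4 := by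
    have hexp : ∀ w, F w = 1 / 8 + 3 / 8 * inner ℝ x w + 3 / 8 * inner ℝ x₀ w - 3 / 8 * inner ℝ y₀ w
        + 9 / 8 * (inner ℝ x w * inner ℝ x₀ w) - 9 / 8 * (inner ℝ x w * inner ℝ y₀ w)
        - 9 / 8 * (inner ℝ x₀ w * inner ℝ y₀ w) - 27 / 8 * (inner ℝ x w * inner ℝ x₀ w * inner ℝ y₀ w) :=
      fun w => by rw [hF]; ring
    rw [Finset.sum_congr rfl fun w _ => hexp w]
    simp only [Finset.sum_add_distrib, Finset.sum_sub_distrib, ← Finset.mul_sum, sum_inner_eq_zero h1 h2 hN,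
      sum_inner_mul_inner h1 h2 hN, sum_inner_mul_inner_mul_inner h1 h2 hN, hxx₀, hxy₀, hx₀y₀, sum_const, hN]
    norm_num
  have hsplit := Finset.sum_filter_add_sum_filter_not C P F
  have hK : ∑ w ∈ C.filter P, F w = ((C.filter P).card : ℝ) := by
    rw [Finset.sum_congr rfl (fun w hw => ?_), sum_const, nsmul_eq_mul, mul_one]
    obtain ⟨_, hw1, hw2, hw3⟩ := mem_filter.mp hw
    rw [hF]
    simp only [hw1, hw2, hw3]
    norm_num
  have hrest : ∑ w ∈ C.filter (fun w => ¬ P w), F w = -1 := by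
    have hval : ∀ w ∈ C.filter (fun w => ¬ P w), F w = if w = y₀ then -1 else 0 := by
      intro w hw
      obtain ⟨hwC, hnp⟩ := mem_filter.mp hw
      by_cases hwy : w = y₀
      · rw [if_pos hwy, hwy, hF]
        simp only [real_inner_self_eq_norm_sq, h1 y₀ hy₀, hxy₀, hx₀y₀]
        norm_num
      rw [if_neg hwy, hF]
      by_cases hwx : w = x
      · rw [hwx]; simp only [hy₀x]; norm_num
      by_cases hwx₀ : w = x₀
      · rw [hwx₀]; simp only [hy₀x₀]; norm_num
      rcases inner_of_card_eq_56 h1 h2 hN hx hwC (Ne.symm hwx) with ha | ha | ha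
      · rcases inner_of_card_eq_56 h1 h2 hN hx₀ hwC (Ne.symm hwx₀) with hb | hb | hb
        · rcases inner_of_card_eq_56 h1 h2 hN hy₀ hwC (Ne.symm hwy) with hc | hc | hc
          · simp only [hc]; norm_num
          · exact absurd ⟨ha, hb, hc⟩ hnp
          · have hw := CrossPolytopeUnique.eq_neg_of_inner_eq_neg_one (h1 y₀ hy₀) (h1 w hwC) hc
            rw [hw, inner_neg_right, hxy₀] at ha
            norm_num at ha
        · simp only [hb]; norm_num
        · have hw := CrossPolytopeUnique.eq_neg_of_inner_eq_neg_one (h1 x₀ hx₀) (h1 w hwC) hb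
          rw [hw, inner_neg_right, hxx₀] at ha
          norm_num at ha
      · simp only [ha]; norm_num
      · have hw := CrossPolytopeUnique.eq_neg_of_inner_eq_neg_one (h1 x hx) (h1 w hwC) ha
        rw [hw]
        simp only [inner_neg_right, hx₀x, hy₀x, real_inner_self_eq_norm_sq, h1 x hx]
        norm_num
    have hym : y₀ ∈ C.filter (fun w => ¬ P w) := by
      refine mem_filter.mpr ⟨hy₀, fun ⟨_, _, h⟩ => ?_⟩
      rw [real_inner_self_eq_norm_sq, h1 y₀ hy₀] at h
      norm_num at h
    rw [Finset.sum_congr rfl hval, Finset.sum_ite_eq' _ y₀, if_pos hym]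
  rw [hK, hrest] at hsplit
  have h5 : ((C.filter P).card : ℝ) = ((5 : ℕ) : ℝ) := by push_cast; linarith
  exact Nat.cast_injective h5

/-- Two distinct points of `K` are at `1/3` from each other. -/
theorem inner_eq_third_of_mem {x x₀ y₀ w w' : EuclideanSpace ℝ (Fin 7)} (hx : x ∈ C)
    (hy₀ : y₀ ∈ C) (hxx₀ : inner ℝ x x₀ = 1 / 3) (hxy₀ : inner ℝ x y₀ = 1 / 3) (hx₀y₀ : inner ℝ x₀ y₀ = 1 / 3)
    (hw : w ∈ C) (hw' : w' ∈ C) (hxw : inner ℝ x w = 1 / 3) (hx₀w : inner ℝ x₀ w = 1 / 3)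
    (hy₀w : inner ℝ y₀ w = -1 / 3) (hxw' : inner ℝ x w' = 1 / 3) (hx₀w' : inner ℝ x₀ w' = 1 / 3)
    (hy₀w' : inner ℝ y₀ w' = -1 / 3) (hne : w ≠ w') : inner ℝ w w' = 1 / 3 := by
  rcases inner_of_card_eq_56 h1 h2 hN hw hw' hne with h | h | h
  · exact h
  · exfalso
    -- `y₀, w, w'` pairwise at `-1/3`, all at `1/3` from `x`: then `y₀ + w + w' = x`
    have h0 : ‖y₀ + w + w' - x‖ ^ 2 = 0 := by
      rw [← real_inner_self_eq_norm_sq]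
      simp only [inner_add_left, inner_add_right, inner_sub_left, inner_sub_right, real_inner_self_eq_norm_sq,
        h1 y₀ hy₀, h1 w hw, h1 w' hw', h1 x hx]
      linarith [real_inner_comm y₀ w, real_inner_comm y₀ w', real_inner_comm w w', real_inner_comm x y₀,
        real_inner_comm x w, real_inner_comm x w']
    have hzero : y₀ + w + w' - x = 0 := norm_eq_zero.mp (pow_eq_zero_iff two_ne_zero |>.mp h0)
    have := congrArg (fun v => inner ℝ x₀ v) hzero
    simp only [inner_add_right, inner_sub_right, inner_zero_right, hx₀y₀, hx₀w, hx₀w', real_inner_comm x x₀,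
      hxx₀] at this
    norm_num at this
  · exfalso
    have hw'' := CrossPolytopeUnique.eq_neg_of_inner_eq_neg_one (h1 w hw) (h1 w' hw') h
    rw [hw'', inner_neg_right, hxw] at hxw'
    norm_num at hxw'

/-- **The frame.** A `(7, 56, 1/3)` code contains seven points pairwise at inner product `1/3`. -/
theorem exists_frame : ∃ a : Fin 7 → EuclideanSpace ℝ (Fin 7), (∀ i, a i ∈ C) ∧
    ∀ i j, inner ℝ (a i) (a j) = if i = j then 1 else 1 / 3 := by
  classical
  have hne : C.Nonempty := by rw [← Finset.card_pos, hN]; norm_num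
  obtain ⟨x, hx⟩ := hne
  obtain ⟨x₀, hx₀, hxx₀⟩ := exists_inner_eq_third h1 h2 hN hx
  have hK2 : (C.filter fun w => inner ℝ x w = 1 / 3 ∧ inner ℝ x₀ w = 1 / 3).Nonempty := by
    rw [← Finset.card_pos, card_filter_eq_sixteen h1 h2 hN hx hx₀ hxx₀]; norm_num
  obtain ⟨y₀, hy₀⟩ := hK2
  obtain ⟨hy₀C, hxy₀, hx₀y₀⟩ := mem_filter.mp hy₀
  have hx₀x : inner ℝ x₀ x = 1 / 3 := by rw [real_inner_comm]; exact hxx₀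
  have hxx₀' : x ≠ x₀ := by
    intro h; rw [h, real_inner_self_eq_norm_sq, h1 x₀ hx₀] at hxx₀; norm_num at hxx₀
  set K := C.filter fun w => inner ℝ x w = 1 / 3 ∧ inner ℝ x₀ w = 1 / 3 ∧ inner ℝ y₀ w = -1 / 3 with hK
  have hxK : x ∉ K := by
    intro h
    have := (mem_filter.mp h).2.1
    rw [real_inner_self_eq_norm_sq, h1 x hx] at this
    norm_num at this
  have hx₀K : x₀ ∉ K := by
    intro h
    have := (mem_filter.mp h).2.2.1
    rw [real_inner_self_eq_norm_sq, h1 x₀ hx₀] at this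
    norm_num at this
  have hx' : x ∉ insert x₀ K := by
    intro h
    rcases mem_insert.mp h with h | h
    · exact hxx₀' h
    · exact hxK h
  set K' := insert x (insert x₀ K) with hK'
  have hcard : Fintype.card K' = 7 := by
    rw [Fintype.card_coe, hK', card_insert_of_notMem hx', card_insert_of_notMem hx₀K,
      card_filter_eq_five h1 h2 hN hx hx₀ hy₀C hxx₀ hxy₀ hx₀y₀]
  have hmemC : ∀ w ∈ K', w ∈ C := by
    intro w hw
    rcases mem_insert.mp hw with rfl | hw
    · exact hx
    rcases mem_insert.mp hw with rfl | hw
    · exact hx₀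
    · exact (mem_filter.mp hw).1
  -- inner products with `x` and `x₀`
  have hKx : ∀ w ∈ insert x₀ K, inner ℝ x w = 1 / 3 := by
    intro w hw
    rcases mem_insert.mp hw with rfl | hw
    · exact hxx₀
    · exact (mem_filter.mp hw).2.1
  have hKx₀ : ∀ w ∈ K, inner ℝ x₀ w = 1 / 3 := fun w hw => (mem_filter.mp hw).2.2.1
  have hKK : ∀ w ∈ K, ∀ w' ∈ K, w ≠ w' → inner ℝ w w' = 1 / 3 := by
    intro w hw w' hw' hne
    obtain ⟨hwC, hxw, hx₀w, hy₀w⟩ := mem_filter.mp hw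
    obtain ⟨hw'C, hxw', hx₀w', hy₀w'⟩ := mem_filter.mp hw'
    exact inner_eq_third_of_mem h1 h2 hN hx hy₀C hxx₀ hxy₀ hx₀y₀ hwC hw'C hxw hx₀w hy₀w hxw' hx₀w' hy₀w' hne
  have hpair0 : ∀ w ∈ insert x₀ K, ∀ w' ∈ insert x₀ K, w ≠ w' → inner ℝ w w' = 1 / 3 := by
    intro w hw w' hw' hne
    rcases mem_insert.mp hw with rfl | hwK
    · rcases mem_insert.mp hw' with rfl | hw'K
      · exact absurd rfl hne
      · exact hKx₀ _ hw'K
    · rcases mem_insert.mp hw' with rfl | hw'K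
      · rw [real_inner_comm]; exact hKx₀ _ hwK
      · exact hKK _ hwK _ hw'K hne
  have hpair : ∀ w ∈ K', ∀ w' ∈ K', w ≠ w' → inner ℝ w w' = 1 / 3 := by
    intro w hw w' hw' hne
    rcases mem_insert.mp hw with rfl | hw0
    · rcases mem_insert.mp hw' with rfl | hw'0
      · exact absurd rfl hne
      · exact hKx _ hw'0
    · rcases mem_insert.mp hw' with rfl | hw'0
      · rw [real_inner_comm]; exact hKx _ hw0
      · exact hpair0 _ hw0 _ hw'0 hne
  let e : K' ≃ Fin 7 := Fintype.equivFinOfCardEq hcard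
  refine ⟨fun i => ((e.symm i : K') : EuclideanSpace ℝ (Fin 7)), fun i => hmemC _ (e.symm i).2, ?_⟩
  intro i j
  by_cases hij : i = j
  · subst hij
    rw [if_pos rfl, real_inner_self_eq_norm_sq, h1 _ (hmemC _ (e.symm i).2), one_pow]
  · rw [if_neg hij]
    have hne : ((e.symm i : K') : EuclideanSpace ℝ (Fin 7)) ≠ (e.symm j : K') := by
      intro h
      exact hij (e.symm.injective (Subtype.ext h))
    exact hpair _ (e.symm i).2 _ (e.symm j).2 hne

end config

end Summit.Ventures.PackingBounds.Config.Dim7Card56Unique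

end
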